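import Summits.Ventures.PercRepro.RankLevelSetPerElemFiveSeries
import Summits.Ventures.PercRepro.RankLevelSetPerElemNullityAll

/-! # RankLevelSetPerElemNullityFive — (★★) AT EVERY LEVEL AND MONO ON EVERY SIMPLE MATROID OF NULLITY `≤ 5` WITHOUT A
SERIES TRIPLE (night-1 g37; dossier §49.12; on `RankLevelSetPerElemFiveSeries` and `RankLevelSetPerElemNullityAll`)

The refined chain of `RankLevelSetPerElemChainTriple` closes a circuit class at level `j` when `#K + 2 ≥ j` —
more generally, with `ρ` the dual rank of the hyperplane, when `s + 2 ≥ ρ`; on a matroid of nullity `≤ 5` every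
hyperplane of the dual has rank `≤ 4`, so EVERY circuit of an element in no parallel pair (`s ≥ 2`) closes at
every level `j ≥ 5` (**`perCircuit_le_of_nullity_five`**; the levels `≤ 4` are `perElemAt_le_four`), provided the
complement of the circuit contains no parallel triple of `M✶` (no series triple of `M`). Hence
**`perElemAt_of_coloopFree_of_nullity_five`** and, removing the coloops by a strong induction on `#E` (the deletion
of a coloop keeps simplicity, the absence of series triples and the nullity bound),
**`biIndepPerElem_of_simple_of_nullity_five`** / **`biIndepMono_of_simple_of_nullity_five`**: (★★) at every level and
Mono on every loopless matroid without parallel pairs, of nullity `≤ 5`, without a series triple — one nullity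
beyond `biIndepPerElem_of_nullity`. (Parallel pairs are not reduced here: the minor `M ／ u ＼ v` may acquire series
triples.) Every declaration has a docstring; imports: the cell's own modules and Mathlib only. Axioms: standard. -/

namespace PercRepro

open Set Matroid

variable {α : Type} (M : Matroid α) [M.Finite]

/-- **THE PER-CIRCUIT INEQUALITY AT EVERY LEVEL `j ≥ 5` WHEN `rk M✶ ≤ 5`** (coloop-free `M`, `y` in no parallel
pair, `2j + 1 < #E`, no parallel triple of `M✶` in the complement of the circuit): the hyperplane has dual rank
`≤ 4`, the refined chain from level `j − s` to level `h − j` closes since `s + 2 ≥ 4`. -/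
theorem perCircuit_le_of_nullity_five (hcol : ∀ e, ¬ M.IsColoop e) {y : α} (hy : y ∈ M.E)
    (hnp : ∀ z, z ≠ y → y ∉ M.closure {z}) (hν : M✶.eRank ≤ 5) {j : ℕ} (hj : 5 ≤ j)
    (hn : 2 * j + 1 < M.E.ncard) {Z₀ : Set α} (hZ₀ : Z₀ ∈ lowAbsorbAt M y j)
    (hnt : ∀ p ∈ M.E \ M.fundCircuit y Z₀, ∀ q ∈ M.E \ M.fundCircuit y Z₀, ∀ r ∈ M.E \ M.fundCircuit y Z₀,
      p ≠ q → p ≠ r → q ≠ r → q ∈ M✶.closure {p} → r ∉ M✶.closure {p}) :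
    {Z ∈ lowAbsorbAt M y j | M.fundCircuit y Z = M.fundCircuit y Z₀}.ncard ≤
      {Q ∈ biIndep M (j + 1) | y ∈ Q ∧ ¬ M.Indep (insert y (M.E \ Q)) ∧
        M.fundCircuit y (M.E \ Q) = M.fundCircuit y Z₀}.ncard := by
  obtain ⟨hKeq, hSZ, hSE, hHE, -, -, hHy, hyH, hnl, -⟩ := circuit_dual_facts M hcol hy hZ₀
  have h1 := members_le_fam M hy hZ₀
  have h2 := fam_le_targets M hy (by omega) hZ₀
  obtain ⟨z₀, hz₀⟩ : (M.E \ {y}).Nonempty := by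
    rw [← Set.ncard_pos (M.ground_finite.subset Set.sdiff_subset), Set.ncard_sdiff_singleton_of_mem hy]
    omega
  have hz₀y : z₀ ≠ y := by simpa using hz₀.2
  have hK3 := (fundCircuit_ncard_absorb M hy hnp hz₀y hZ₀).1
  have hZE : Z₀ ⊆ M.E := hZ₀.1.1
  have hZj : Z₀.ncard = j := hZ₀.1.2.1
  set K := M.fundCircuit y Z₀ with hK'
  set S := K \ {y} with hS
  set H := M.E \ K with hH
  have hyK : y ∈ K := M.mem_fundCircuit y Z₀
  have hKE : K ⊆ M.E := hKeq ▸ Set.insert_subset hy hSE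
  have hKfin : K.Finite := M.ground_finite.subset hKE
  have hKcard : K.ncard = S.ncard + 1 := by
    rw [hS, Set.ncard_sdiff_singleton_of_mem hyK]
    have : 1 ≤ K.ncard := (Set.ncard_pos hKfin).mpr ⟨y, hyK⟩
    omega
  have hKle : K.ncard ≤ M.E.ncard := Set.ncard_le_ncard hKE M.ground_finite
  have hHcard : H.ncard + K.ncard = M.E.ncard := by
    rw [hH, Set.ncard_sdiff hKE hKfin]; omega
  have hsj : S.ncard ≤ j := by
    rw [← hZj]; exact Set.ncard_le_ncard hSZ (M.ground_finite.subset hZE)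
  have hyE' : y ∈ M✶.E := by rwa [Matroid.dual_ground]
  have hHE' : H ⊆ M✶.E := by rwa [Matroid.dual_ground]
  have hSE' : S ⊆ M✶.E := by rwa [Matroid.dual_ground]
  -- the rank of `H` in the dual is at most `4`
  have hρ : M✶.eRk H ≤ ((4 : ℕ) : ℕ∞) := by
    have h : M✶.eRk H + 1 ≤ ((4 : ℕ) : ℕ∞) + 1 := by
      rw [eRk_add_one_eq_eRank_of_spanning_insert hyE' hyH hHy]
      exact_mod_cast hν
    exact (WithTop.add_le_add_iff_right (by decide)).mp h
  set f : ℕ → ℕ := fun i =>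
    {X | X ⊆ H ∧ X.ncard = i ∧ M✶.Spanning (S ∪ X) ∧ M✶.Spanning (insert y (H \ X))}.ncard with hf
  have hchain : f (j - S.ncard) ≤ f (H.ncard - j) := by
    have hm : H.ncard - j = (j - S.ncard) + ((H.ncard + S.ncard) - 2 * j) := by omega
    rw [hm]
    refine le_of_chain f (c := H.ncard - 2 - (j - S.ncard)) (by omega) ?_
    intro t ht
    have hstep := absorbFam_step_of_no_triple (S := S) hHE' hSE' hyE' hyH hHy hnl hnt hρ
      (i := j - S.ncard + t) (by omega)
    have e1 : H.ncard - (j - S.ncard + t) - (4 - 2) = H.ncard - 2 - (j - S.ncard) - t := by omega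
    rw [e1] at hstep
    exact hstep
  calc {Z ∈ lowAbsorbAt M y j | M.fundCircuit y Z = M.fundCircuit y Z₀}.ncard ≤ f (j - S.ncard) := h1
    _ ≤ f (H.ncard - j) := hchain
    _ ≤ _ := h2

/-- **(★★) AT EVERY LEVEL ON A COLOOP-FREE MATROID OF NULLITY `≤ 5` WITHOUT A SERIES TRIPLE, AT AN ELEMENT IN NO
PARALLEL PAIR** (`2j + 1 < #E`): the levels `≤ 4` are `perElemAt_le_four`, the levels `≥ 5` the refined chain. -/
theorem perElemAt_of_coloopFree_of_nullity_five (hcol : ∀ e, ¬ M.IsColoop e) (hnt : NoSeriesTriple M)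
    {y : α} (hy : y ∈ M.E) (hnp : ∀ z, z ≠ y → y ∉ M.closure {z}) (hν : M✶.eRank ≤ 5) {j : ℕ}
    (hn : 2 * j + 1 < M.E.ncard) :
    {Z ∈ biIndep M j | y ∉ Z}.ncard ≤ {Q ∈ biIndep M (j + 1) | y ∈ Q}.ncard := by
  rcases Nat.lt_or_ge j 5 with h4 | h5
  · exact perElemAt_le_four M hy (by omega) hn
  · refine perElemAt_of_perCircuit M hy j ?_
    intro Z₀ hZ₀
    refine perCircuit_le_of_nullity_five M hcol hy hnp hν h5 hn hZ₀ ?_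
    intro p hp q hq r hr hpq hpr hqr hq' hr'
    have hpnl : M✶.IsNonloop p := by
      refine Matroid.isNonloop_of_not_isLoop (by rw [Matroid.dual_ground]; exact hp.1) ?_
      rw [Matroid.dual_isLoop_iff_isColoop]
      exact hcol p
    exact hnt p q r hpq hpr hqr hpnl hq' hr'

/-- **(★★) AT EVERY LEVEL ON EVERY SIMPLE MATROID OF NULLITY `≤ 5` WITHOUT A SERIES TRIPLE** (the auxiliary form,
by strong induction on `#E` removing the coloops: `M ＼ x` is simple, without series triples, of nullity `≤ 5`). -/
theorem perElemAt_of_simple_of_nullity_five_aux :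
    ∀ n : ℕ, ∀ (M' : Matroid α) [M'.Finite], M'.E.ncard = n → (∀ e, ¬ M'.IsLoop e) →
      (∀ u v, ¬ ParallelPair M' u v) → NoSeriesTriple M' → M'✶.eRank ≤ 5 → ∀ y ∈ M'.E, ∀ j : ℕ,
      2 * j + 1 < n → {Z ∈ biIndep M' j | y ∉ Z}.ncard ≤ {Q ∈ biIndep M' (j + 1) | y ∈ Q}.ncard := by
  intro n
  induction n using Nat.strong_induction_on with
  | _ n ih =>
    intro M' _ hn hloop hpar hnt hν y hy j hj
    -- level `0`
    rcases Nat.eq_zero_or_pos j with rfl | hj0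
    · exact perElemAt_zero M' hy
    obtain ⟨j, rfl⟩ : ∃ j', j = j' + 1 := ⟨j - 1, by omega⟩
    -- a coloop anywhere
    by_cases hcol : ∃ x, M'.IsColoop x
    · obtain ⟨x, hx⟩ := hcol
      haveI := delete_finite' M' x
      have hcard : (M'.delete {x}).E.ncard = n - 1 := by
        rw [Matroid.delete_ground, Set.ncard_sdiff_singleton_of_mem hx.mem_ground, hn]
      have hν' : (M'.delete {x})✶.eRank ≤ 5 := le_trans (eRank_dual_delete_le M' _) hν
      have hloop' : ∀ e, ¬ (M'.delete {x}).IsLoop e := fun e he => hloop e (Matroid.delete_isLoop_iff.mp he).1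
      have hpar' : ∀ u v, ¬ ParallelPair (M'.delete {x}) u v := by
        intro u v huv
        obtain ⟨hne, hu, hv, hdep⟩ := huv
        have hu' := Matroid.delete_isNonloop_iff.mp hu
        have hv' := Matroid.delete_isNonloop_iff.mp hv
        refine hpar u v ⟨hne, hu'.1, hv'.1, fun hind => hdep ?_⟩
        rw [Matroid.delete_indep_iff]
        refine ⟨hind, ?_⟩
        rw [Set.disjoint_singleton_right]
        simp only [Set.mem_insert_iff, Set.mem_singleton_iff, not_or]
        exact ⟨fun h => hu'.2 (by rw [← h]; exact Set.mem_singleton x),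
          fun h => hv'.2 (by rw [← h]; exact Set.mem_singleton x)⟩
      have hnt' : NoSeriesTriple (M'.delete {x}) := noSeriesTriple_delete_of_isColoop M' hnt hx
      by_cases hyx : y = x
      · subst hyx
        exact (perElem_coloop_self M' hx (j + 1)).le
      · have hyM : y ∈ (M'.delete {x}).E := by
          rw [Matroid.delete_ground]
          exact ⟨hy, by simpa using hyx⟩
        refine perElem_succ_of_coloop M' hx hyx j
          (ih (n - 1) (by omega) _ hcard hloop' hpar' hnt' hν' y hyM j (by omega)) ?_
        rcases Nat.lt_or_ge (2 * (j + 1) + 1) (n - 1) with hlt | hge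
        · exact ih (n - 1) (by omega) _ hcard hloop' hpar' hnt' hν' y hyM (j + 1) hlt
        · exact (perElem_middle_eq (M'.delete {x}) hyM (j + 1) (by omega)).le
    simp only [not_exists] at hcol
    exact perElemAt_of_coloopFree_of_nullity_five M' hcol hnt hy
      (fun _ hz => notMem_closure_singleton_of_no_partner M' hy (hloop y) (hpar y) hz) hν (by omega)

/-- **(★★) HOLDS ON EVERY LOOPLESS MATROID WITHOUT PARALLEL PAIRS AND SERIES TRIPLES OF NULLITY `≤ 5`.** -/
theorem biIndepPerElem_of_simple_of_nullity_five (hl : ∀ e, ¬ M.IsLoop e) (hp : ∀ u v, ¬ ParallelPair M u v)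
    (hnt : NoSeriesTriple M) (hν : M✶.eRank ≤ 5) : BiIndepPerElem M :=
  fun y hy j hj => perElemAt_of_simple_of_nullity_five_aux M.E.ncard M rfl hl hp hnt hν y hy j hj

/-- **MONO HOLDS ON EVERY LOOPLESS MATROID WITHOUT PARALLEL PAIRS AND SERIES TRIPLES OF NULLITY `≤ 5`.** -/
theorem biIndepMono_of_simple_of_nullity_five (hl : ∀ e, ¬ M.IsLoop e) (hp : ∀ u v, ¬ ParallelPair M u v)
    (hnt : NoSeriesTriple M) (hν : M✶.eRank ≤ 5) : BiIndepMono M :=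
  biIndepMono_of_perElem M (biIndepPerElem_of_simple_of_nullity_five M hl hp hnt hν)

end PercRepro
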